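import Summits.QuantumFields.BalabanUV.T4Continuum.Spine.NE9.DirectPairingMargin

/-!
# T⁴ programme, spine estimate NE9 — THE OPEN WINDOW: in the g-currency on `]0, γ]` the analytic branch's RELATIVE-DISC holomorphy with a
# uniform bound does NOT give King's [UC-LAST]; the same coupling dependence IS uniformly continuous in node U2's t-currency — the currency
# clause of census C37 made two-sided — census item C37c of cell `pub-balaban-gaps`, seat ne9 (gen 9)

Cell `pub-balaban-gaps` (YM blitz G2, seat ne9, unit `pub-balaban-gaps-ne9-g9`; record `run/shared/lean/pub/pub-balaban-gaps/ne/NE9.md` §5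
row C37c).  Summits-side bookkeeping; one-variable complex∕real analysis on a WITNESS; NO definition; nothing of Bałaban's asserted.

CONTEXT.  `DirectPairingMargin` §2 (C37) proved: on the t-box `[t₀, ∞[` the relative discs `|z − t| ≤ c|t|` of the analytic branch ([H-dil],
`AnalyticBranchPropagation.NormCouplingAnalyticRel`; [Balaban1987RG1] p. 266 *"analytic functions of the effective coupling constants"*) contain
uniform discs, so [H-dil] + a run-uniform bound is a MARGIN and gives [UC-LAST] (`uniformLast_of_relDisc`).  Its docstring asserted the converse
failure in the g-currency without proof.  This file proves it.

WHAT IS PROVED (0 sorry).  The coupling dependence `g ↦ sin(log g)` on the OPEN window `]0, 1]` (scale-periodic):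
* `relDisc_subset_halfPlane`: the relative discs `|z − g| ≤ |g|∕2`, `g > 0`, lie in the right half-plane;
* `sinLog_holo` ∕ `sinLog_bound` ∕ `sinLog_restrict`: `z ↦ sin(log z)` is holomorphic on the right half-plane, bounded there by `e^{π∕2}` (since
  `|Im log z| = |arg z| < π∕2` and `‖sin w‖ ≤ (e^{Im w} + e^{−Im w})∕2`), and restricts to `sin(log g)` on `g > 0` — so `sinLog_relDisc_hyps`: the
  [H-dil]-type hypothesis «holomorphic on a set containing the closed relative discs about every point of `]0, 1]`, uniformly bounded there» HOLDS
  (relative constant `1∕2`, bound `e^{π∕2}`);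
* `sinLog_not_uniformLast`: yet `g ↦ sin(log g)` is NOT uniformly continuous on `]0, 1]` — at `g = e^{−2πn}` and `g' = e^{−2πn − π∕2}` (both in the
  window, `|g − g'| ≤ e^{−n} → 0`) the values are `0` and `−1`: King's [UC-LAST] in the g-currency FAILS on the open window under relative-disc
  holomorphy + a uniform bound;
* `sinLog_uniform_in_t`: in node U2's t-currency `g = e^{−t}` the same dependence is `t ↦ −sin t`, Lipschitz `1` on all of `ℝ` — consistent with
  `uniformLast_of_relDisc` (relative g-discs = uniform t-discs).
So the currency in which King's qualitative clause is ASKED is load-bearing: t-currency (node U2's native box, `DirectPairingPropagationCarriers.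
sepUC_tCoord_of_gCoord`) or print's CLOSED g-interval `[0, γ]` with continuity AT `g = 0` ([I] p. 263 *"C^∞-function of g_{j−1} ∈ [0, γ]"*; [I]
(2.13) p. 268 *"the expression under the exponential above vanishes at g_k = 0"*) — never the open window with relative discs alone.

HONEST FRAMING: a witness about hypothesis SHAPES; nothing of Bałaban's asserted; [H-dil] for Bałaban's step NOT PRINTED as a theorem ∕ NOT PROVED;
NE9 NOT PRINTED ∕ NOT PROVED; spine 0∕9; instance 0∕1; NOT continuum ∕ ℝ⁴ ∕ mass gap ∕ Clay.  CLASSIFICATION OF NE9 UNCHANGED: WORK-bound (W1).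

References (TYPES only): [Balaban1987RG1] = T. Bałaban, Commun. Math. Phys. **109** (1987) 249–301, p. 263, p. 266, (2.13) p. 268; [King1986] =
C. King, Commun. Math. Phys. **102** (1986) 649–677, §3.2.
-/

namespace Summit.QuantumFields.BalabanUV.T4Continuum.NE9.DirectPairingMarginWindow

open Metric Set Complex

/-! ## §1 The relative discs of the open window and the witness `sin ∘ log` -/

/-- The closed relative disc `|z − g| ≤ |g|∕2` about a point `g > 0` of the window lies in the open right half-plane. [folklore] -/
theorem relDisc_subset_halfPlane {g : ℝ} (hg : 0 < g) : closedBall (g : ℂ) (1 / 2 * |g|) ⊆ {z : ℂ | 0 < z.re} := by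
  intro z hz
  rw [mem_closedBall, dist_eq_norm, abs_of_pos hg] at hz
  have h1 : |(z - g).re| ≤ ‖z - (g : ℂ)‖ := abs_re_le_norm _
  rw [sub_re, ofReal_re] at h1
  have h2 : -(1 / 2 * g) ≤ z.re - g := by
    have := (abs_le.mp (h1.trans hz)).1
    linarith
  show 0 < z.re
  linarith

/-- `z ↦ sin(log z)` is holomorphic on the open right half-plane (inside the slit plane). [folklore] -/
theorem sinLog_holo : DifferentiableOn ℂ (fun z : ℂ => Complex.sin (Complex.log z)) {z : ℂ | 0 < z.re} := by
  intro z hz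
  have h1 : DifferentiableAt ℂ (fun t : ℂ => Complex.log t) z :=
    differentiableAt_id.clog (mem_slitPlane_iff.2 (Or.inl hz))
  exact h1.csin.differentiableWithinAt

/-- `‖sin w‖ ≤ (e^{Im w} + e^{−Im w})∕2` for every complex `w` (from `sin w = (e^{−iw} − e^{iw})·i∕2` and `‖e^{z}‖ = e^{Re z}`). [folklore] -/
theorem norm_sin_le_exp (w : ℂ) : ‖Complex.sin w‖ ≤ (Real.exp w.im + Real.exp (-w.im)) / 2 := by
  have hdef : Complex.sin w = (Complex.exp (-w * I) - Complex.exp (w * I)) * I / 2 := rfl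
  have h1 : ‖Complex.exp (-w * I)‖ = Real.exp w.im := by
    rw [norm_exp]; congr 1; simp [mul_re]
  have h2 : ‖Complex.exp (w * I)‖ = Real.exp (-w.im) := by
    rw [norm_exp]; congr 1; simp [mul_re]
  rw [hdef, norm_div, norm_mul, norm_I, mul_one]
  have h3 : ‖Complex.exp (-w * I) - Complex.exp (w * I)‖ ≤ Real.exp w.im + Real.exp (-w.im) := by
    rw [← h1, ← h2]; exact norm_sub_le _ _
  have h4 : ‖(2 : ℂ)‖ = 2 := by norm_num
  rw [h4]
  linarith

/-- On the right half-plane `‖sin(log z)‖ ≤ e^{π∕2}`: `|Im log z| = |arg z| < π∕2`. [folklore] -/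
theorem sinLog_bound : ∀ z ∈ {z : ℂ | 0 < z.re}, ‖Complex.sin (Complex.log z)‖ ≤ Real.exp (Real.pi / 2) := by
  intro z hz
  have harg : |(Complex.log z).im| < Real.pi / 2 := by
    rw [log_im]
    exact abs_arg_lt_pi_div_two_iff.2 (Or.inl hz)
  have hb := abs_lt.mp harg
  have e1 : Real.exp (Complex.log z).im ≤ Real.exp (Real.pi / 2) := Real.exp_le_exp.2 hb.2.le
  have e2 : Real.exp (-(Complex.log z).im) ≤ Real.exp (Real.pi / 2) := Real.exp_le_exp.2 (by linarith)
  calc ‖Complex.sin (Complex.log z)‖ ≤ (Real.exp (Complex.log z).im + Real.exp (-(Complex.log z).im)) / 2 := norm_sin_le_exp _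
    _ ≤ Real.exp (Real.pi / 2) := by linarith

/-- The restriction to the positive reals is `g ↦ sin(log g)`. [folklore] -/
theorem sinLog_restrict {g : ℝ} (hg : 0 < g) : Complex.sin (Complex.log g) = (Real.sin (Real.log g) : ℂ) := by
  rw [← ofReal_log hg.le, ← ofReal_sin]

/-- **THE [H-dil]-TYPE HYPOTHESIS HOLDS IN THE g-CURRENCY ON THE OPEN WINDOW**: `g ↦ sin(log g)` on `]0, 1]` is the restriction of a function
holomorphic on a set containing the closed RELATIVE discs `|z − g| ≤ |g|∕2` about every point of the window, bounded there by `e^{π∕2}` — the shape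
of `AnalyticBranchPropagation.NormCouplingAnalyticRel` (relative constant `1∕2`) with a uniform bound. [folklore] -/
theorem sinLog_relDisc_hyps :
    ∃ (Ψ : ℂ → ℂ) (D : Set ℂ), DifferentiableOn ℂ Ψ D ∧ (∀ z ∈ D, ‖Ψ z‖ ≤ Real.exp (Real.pi / 2)) ∧
      (∀ g ∈ Ioc (0 : ℝ) 1, closedBall (g : ℂ) (1 / 2 * |g|) ⊆ D) ∧ ∀ g ∈ Ioc (0 : ℝ) 1, Ψ g = (Real.sin (Real.log g) : ℂ) :=
  ⟨fun z => Complex.sin (Complex.log z), {z | 0 < z.re}, sinLog_holo, sinLog_bound,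
    fun _ hg => relDisc_subset_halfPlane hg.1, fun _ hg => sinLog_restrict hg.1⟩

/-! ## §2 … yet [UC-LAST] fails in the g-currency on the open window, and holds in the t-currency -/

/-- **KING'S [UC-LAST] FAILS IN THE g-CURRENCY ON THE OPEN WINDOW**: `g ↦ sin(log g)` is not uniformly continuous on `]0, 1]` — for every
`δ > 0`, at `g = e^{−2πn}`, `g' = e^{−2πn − π∕2}` with `n > 1∕δ` the couplings are `δ`-close and the values `0`, `−1` are `1` apart.  Together with
`sinLog_relDisc_hyps`: relative-disc holomorphy + a uniform bound ⇏ [UC-LAST] on `]0, γ]`. [folklore] -/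
theorem sinLog_not_uniformLast :
    ¬ (∀ ε : ℝ, 0 < ε → ∃ δ : ℝ, 0 < δ ∧ ∀ g ∈ Ioc (0 : ℝ) 1, ∀ g' ∈ Ioc (0 : ℝ) 1,
        |g - g'| ≤ δ → |Real.sin (Real.log g) - Real.sin (Real.log g')| ≤ ε) := by
  intro h
  obtain ⟨δ, hδ, h⟩ := h (1 / 2) (by norm_num)
  obtain ⟨n, hn⟩ := exists_nat_gt (1 / δ)
  have hn0 : (0 : ℝ) < n := lt_trans (by positivity) hn
  have hpi := Real.pi_pos
  set a : ℝ := (n : ℝ) * (2 * Real.pi) with ha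
  have ha0 : 0 ≤ a := by positivity
  -- the two couplings
  set g : ℝ := Real.exp (-a) with hg
  set g' : ℝ := Real.exp (-(a + Real.pi / 2)) with hg'
  have hgI : g ∈ Ioc (0 : ℝ) 1 := ⟨Real.exp_pos _, Real.exp_le_one_iff.2 (by linarith)⟩
  have hg'I : g' ∈ Ioc (0 : ℝ) 1 := ⟨Real.exp_pos _, Real.exp_le_one_iff.2 (by linarith)⟩
  -- they are δ-close: |g − g'| ≤ g ≤ e^{−n} ≤ 1/(n+1) < δ
  have hclose : |g - g'| ≤ δ := by
    have hle : g' ≤ g := Real.exp_le_exp.2 (by linarith)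
    rw [abs_of_nonneg (sub_nonneg.2 hle)]
    have h1 : g ≤ Real.exp (-(n : ℝ)) := by
      refine Real.exp_le_exp.2 ?_
      have : (n : ℝ) ≤ a := by
        rw [ha]; nlinarith [Real.pi_gt_three]
      linarith
    have h2 : Real.exp (-(n : ℝ)) ≤ 1 / ((n : ℝ) + 1) := by
      rw [Real.exp_neg, one_div]
      exact inv_anti₀ (by positivity) (Real.add_one_le_exp _)
    have h3 : 1 / ((n : ℝ) + 1) < δ := by
      rw [div_lt_iff₀ (by positivity)]
      have := (div_lt_iff₀ hδ).mp hn
      nlinarith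
    linarith [Real.exp_pos (-(a + Real.pi / 2))]
  have key := h g hgI g' hg'I hclose
  -- the values: sin(log g) = sin(−2πn) = 0, sin(log g') = sin(−2πn − π/2) = −1
  have hv1 : Real.sin (Real.log g) = 0 := by
    rw [hg, Real.log_exp, Real.sin_neg, ha, Real.sin_periodic.nat_mul_eq, Real.sin_zero, neg_zero]
  have hv2 : Real.sin (Real.log g') = -1 := by
    rw [hg', Real.log_exp, Real.sin_neg, Real.sin_add_pi_div_two, ha, Real.cos_nat_mul_two_pi]
  rw [hv1, hv2] at key
  norm_num at key

/-- **… AND HOLDS IN THE t-CURRENCY**: with `g = e^{−t}` the same dependence is `t ↦ sin(log e^{−t}) = −sin t`, Lipschitz `1` on `ℝ` — uniformly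
continuous on every t-box, as `DirectPairingMargin.uniformLast_of_relDisc` predicts (relative g-discs are uniform t-discs). [folklore] -/
theorem sinLog_uniform_in_t (t t' : ℝ) :
    |Real.sin (Real.log (Real.exp (-t))) - Real.sin (Real.log (Real.exp (-t')))| ≤ |t - t'| := by
  rw [Real.log_exp, Real.log_exp]
  calc |Real.sin (-t) - Real.sin (-t')| ≤ |(-t) - (-t')| := Real.abs_sin_sub_sin_le _ _
    _ = |t - t'| := by rw [neg_sub_neg, abs_sub_comm]

end Summit.QuantumFields.BalabanUV.T4Continuum.NE9.DirectPairingMarginWindow
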